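import Summits.Schanuel.Schanuel.Theorems.RootDecomp1ELevelTransport02

/-!
# RootDecomp1ELevelTransport — lens 2, generation 43 «POWER TRANSPORT — norm the transcendental LEVEL, not only the radix» (lanes E-R20 (β) + E-R19 (ii) + (α′); VERDICT L2157: THEOREM ×1 «hX-ELIMINATION on the tree class InRadixClass by level transport» + ONE CELL on the `√2·log 2`-weighted radix class `InQuadRadixClass` with E-STABLE members `zGS`, mod the ONE new print-faithful named fact `Waldschmidt1978_thm_4_7` (Literature)): the second resultant `powerNorm 𝔐 R₀ = Res_X(R₀(X), X^𝔐 − Y)` = the norm N_{ℚ(κ)(x)/ℚ(κ)} written in κ, transcendence TYPE as the only diophantine input, the λ-weighted radix curve, the level-transport engine, T1 binder-free radix line, T3 cells serving item 31409 — continuation (RootDecomp1ELevelTransport03): §4 THE LEVEL-TRANSPORT ENGINE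

(lens-2 g43 HOME kernel LevelTransport.lean — graded copy 6f4fbb98… 1285 l; ported copy 746096cb… = graded + the critic's PORT CONDITION K:1117 `z ↦ w` in the carried IH binder of `cell_31410 (h47)` (one token, applied by the lens 17:36Z); imports tree RootDecomp1ERadixCell07 + Literature ExpOneTranscendenceMeasureProofs + Mathlib KummerExtension; CLAIM L2118, ACK/CHECKLIST E-g43 L2127, NODE L2152 / REQUEST L2153, writer re-check L2156, critic VERDICT L2157 (CLEARED as priced: THEOREM ×1 (T1) + ONE CELL (T3); lens-2 tally CELL ×5 + THEOREM ×1; RULE E-R21 L2158; PORT GO 01–0k `--supports stmt-Schanuel-31409`); port by census-1 gen 18 as `RootDecomp1ELevelTransport01`–`04`: 01 = §1 the power norm `powerNorm` / `norm_aeval_powerNorm` / `map_powerNorm_eq` / `natDegree_powerNorm` / `powerNorm_ne_zero` + §2 `TranscendenceType` (DEFINITION), `transcendenceType_exp_mul_log (h47)` (α^β has type 5); 02 = §3 the λ-weighted radix curve `radixPtL` + §4 engine helpers; 03 = §4 THE LEVEL-TRANSPORT ENGINE `algebraicIndependent_radixPtL_of_type` (scoped `maxHeartbeats 800000` as in K);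 04 = §5 T1 binder-free (`algebraicIndependent_radixPt_free`, `schanuel_inRadixClass_free`, `cell_25020_free` / `cell_31410_free`, `schanuel_zMix_towerNumber_free`), T3 `InQuadRadixClass` (DEFINITION), `transcendenceType_two_pow_sqrt_two (h47)`, `schanuel_inQuadRadixClass (h47)`, `cell_31409 (h47)` / `cell_25020 (h47)` / `cell_31410 (h47)`, members `zGS`, `eStable_zGS`, `schanuel_zGS_towerNumber (h47)`, separation, the dichotomy `not_transcendenceType_of_isAlgebraic` / `not_transcendenceType_two`.
PORT EDITS: the named fact `def Waldschmidt1978_thm_4_7` MOVED to the NEW Literature statement file Literature/NumberTheory/Transcendental/AlphaBetaTranscendenceMeasure.lean (census proposal, [cite: Waldschmidt1978, Thm 4.7]) and referenced through `open Literature.NumberTheory.Transcendental (Waldschmidt1978_thm_4_7)`; K's six private helpers as per-part private copies; statements and proofs otherwise verbatim (0 undocumented decls in K). `--supports stmt-Schanuel-31409`; no census credit carried; rung 0 — nothing here proves Schanuel; items 31409/25020/31410 stay OPEN.)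
-/

noncomputable section

open Complex Polynomial IntermediateField Filter
open scoped BigOperators Topology

namespace Summit.Schanuel.Schanuel.Theorems.RootDecomp1ELevelTransport

open Summit.Schanuel.Schanuel.Theorems.RootDecomp1ERadixCell
open Summit.Schanuel.Schanuel.Theorems.RootDecomp1EUntwistedWall (gι gaussPt expo coef tail fib IsZ wden wden_pos
  isZ_expo Wb Wb_nonneg abs_expo_le abs_coef_le coef_cast fib_ne_zero expo_eq_of_tail_eq)
open Summit.Schanuel.Schanuel.Theorems.RootDecomp1KHyper
open Summit.Schanuel.Schanuel.Theorems.RootDecomp1KHyper.HyperCell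
open Summit.Schanuel.Schanuel.Theorems.RootDecomp1KGeneric (LiouvilleOrder)
open Summit.Schanuel.Schanuel.Theorems.RootDecomp1KFiniteOrderCell (towerNumber liouvilleOrder_towerNumber
  not_hyperLiouville_towerNumber towerNumber_pos not_liouvilleOrder_towerNumber)
open Summit.Schanuel.Schanuel.Theorems.RootDecomp1BDefectFloorCells (natCast_le_trdeg_of_algebraicIndependent)
open Summit.Schanuel.Schanuel.Theorems.RootDecomp1BRadicalDescent (exists_int_relation)
open Literature.NumberTheory.Transcendental (Waldschmidt1978_thm_4_7)

section Engine

variable {n : ℕ}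

/-- Each exponent of a support monomial is at most the total degree (tree one-liner, private copy). -/
private theorem apply_le_totalDegree' {P : MvPolynomial (Fin (n + 1)) ℤ} {s : Fin (n + 1) →₀ ℕ}
    (hs : s ∈ P.support) (i : Fin (n + 1)) : s i ≤ P.totalDegree := by
  refine le_trans ?_ (MvPolynomial.le_totalDegree hs)
  by_cases hi : i ∈ s.support
  · exact Finset.single_le_sum (f := fun j => s j) (fun _ _ => Nat.zero_le _) hi
  · simp [Finsupp.notMem_support_iff.mp hi]

set_option maxHeartbeats 800000 in
/-- **THE LEVEL-TRANSPORT ENGINE.**  Let `λ > 0` be real such that `κ = e^λ` has a transcendence TYPE `τ`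
(`TranscendenceType (cexp λ) τ`: `|P(κ)| ≥ exp(−C (deg P + log H(P))^τ)` for all `P ∈ ℤ[X] ∖ 0` — LNM 402
(4.1.1)).  For `T > 0` real of exponential order `m ≥ (2Σ_l e_l + 1)·τ + 1` (and `m ≥ 3`), rational
`u_l, v_l ≥ 0` (`v_l = 0` where `e_l = 0`) with the monomials `(u_l + i v_l) X^{e_l}` `ℤ`-free:
`T, κ^{u₁T^{e₁}}2^{v₁T^{e₁}}, …, κ^{u_nT^{e_n}}2^{v_nT^{e_n}}` are algebraically independent over `ℚ`.
MECHANISM: g42's collapse + radix norm `R₀ = Res_Y(Y^𝔐 − 2, F) ∈ ℤ[X]` VERBATIM (tree parts 01–05 by name),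
`‖R₀(x_λ)‖ ≤ M (q^D c)^𝔐 e^{−q^m}` at the level `x_λ = e^{λ/𝔐}`, and on the whole circle `‖z‖ = x_λ`:
`‖R₀(z)‖ ≤ (q^D c)^𝔐`; then the POWER NORM `R̃ = Res_X(R₀, X^𝔐 − Y)`: `‖R̃(κ)‖ = ∏_j ‖R₀(ζ^j x_λ)‖ ≤
M (q^D c)^{𝔐²} e^{−q^m}`, `deg R̃ = deg R₀ ≲ q^{2K}`, `log H(R̃) ≲ 𝔐² q ≲ q^{2K+1}` — so the type of the FIXED
`κ` gives `‖R̃(κ)‖ ≥ exp(−C q^{(2K+1)τ})`: contradiction at order `(2K+1)τ + 1` (`endgame_transport`).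
Constant `R₀`: the pure endgame `endgame_pure` (tree) at order `K + 2`. -/
theorem algebraicIndependent_radixPtL_of_type {lam : ℝ} (hlam : 0 < lam) {τ : ℕ} (hτ : 1 ≤ τ)
    (hκ : TranscendenceType (cexp (lam : ℂ)) τ) (w : Fin n → ℚ × ℚ) (e : Fin n → ℕ) {T : ℝ} (hT0 : 0 < T)
    {m : ℕ} (hT : LiouvilleOrder m T) (hm : (2 * (∑ l, e l) + 1) * τ + 1 ≤ m) (hm3 : 3 ≤ m)
    (hu : ∀ l, 0 ≤ (w l).1) (hv : ∀ l, 0 ≤ (w l).2) (hv0 : ∀ l, e l = 0 → (w l).2 = 0)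
    (hLI : LinearIndependent ℤ (fun l : Fin n => Polynomial.monomial (e l) (gι (w l)))) :
    AlgebraicIndependent ℚ (radixPtL lam w e (T : ℂ)) := by
  classical
  by_contra hdep
  obtain ⟨P, hP0, hPu⟩ := exists_int_relation hdep
  have hFT : FRL lam P w e T = 0 := by rw [FRL_eq_aeval]; exact hPu
  set D : ℕ := P.totalDegree with hDdef
  have hD : ∀ s ∈ P.support, ∀ i, s i ≤ D := fun s hs i => apply_le_totalDegree' hs i
  have hD0 : ∀ s ∈ P.support, s 0 ≤ D := fun s hs => hD s hs 0
  obtain ⟨t, ht⟩ : ∃ t, t ∈ P.support := by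
    obtain ⟨t, ht⟩ := MvPolynomial.ne_zero_iff.mp hP0
    exact ⟨t, MvPolynomial.mem_support_iff.mpr ht⟩
  have hTt : Transcendental ℚ T := transcendental_of_liouvilleOrder hm3 hT
  -- ROOT AND RESIDUE AVOIDANCE, eventually near `T` (λ-free: tree part 03)
  set pairs : Finset ((Fin n → ℕ) × (Fin n → ℕ)) :=
    ((P.support.image tail) ×ˢ (P.support.image tail)).filter (fun p => p.1 ≠ p.2) with hpairs
  have hev : ∀ᶠ x : ℝ in 𝓝 T, aeval x (fib P (tail t)) ≠ 0 ∧ ∀ p ∈ pairs,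
      (aeval x (Δ1 w e p.1 p.2) ≠ 0 ∨ aeval x (Δ2 w e p.1 p.2) ∉ Set.range (Int.cast : ℤ → ℝ)) := by
    refine (eventually_fib_ne_zero P ht hTt).and ?_
    rw [Filter.eventually_all_finset]
    intro p hp
    exact eventually_avoid hLI hv0 hTt (Finset.mem_filter.mp hp).2
  obtain ⟨δ₀, hδ₀, hball⟩ := Metric.eventually_nhds_iff.mp hev
  obtain ⟨Kl, δ₁, hKl0, hδ₁, hlip⟩ := exists_lipschitz_FRL lam P w e T
  obtain ⟨Ct, hCt0, hmeas⟩ := hκ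
  set M : ℝ := Kl + 1 with hM
  have hM0 : 0 < M := by rw [hM]; linarith
  -- constants (depend on `T, w, e, P, λ, C_t, τ` only)
  set K : ℕ := ∑ l, e l with hK
  set a : ℕ := 2 * K + 1 with ha
  set R : ℝ := T + 2 with hR
  have hR1 : 1 ≤ R := by rw [hR]; linarith
  have hR0 : 0 ≤ R := by linarith
  set Lr : ℝ := ∑ s ∈ P.support, |((MvPolynomial.coeff s P : ℤ) : ℝ)| with hLr
  have hLr0 : 0 ≤ Lr := Finset.sum_nonneg fun s _ => abs_nonneg _
  have hWb0 : 0 ≤ Wb w e R := Wb_nonneg w e hR0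
  set Λ : ℝ := lam + 1 with hΛ
  have hΛ1 : 1 ≤ Λ := by rw [hΛ]; linarith
  have hΛlam : lam ≤ Λ := by rw [hΛ]; linarith
  have hΛ0 : 0 ≤ Λ := by linarith
  set cG : ℝ := Lr * (R ^ D * Real.exp (Λ * ((D : ℝ) * Wb w e R))) + 1 with hcG
  have hcGm : 0 ≤ Lr * (R ^ D * Real.exp (Λ * ((D : ℝ) * Wb w e R))) := by positivity
  have hcG1 : 1 ≤ cG := by rw [hcG]; linarith
  have hcG0 : 0 ≤ cG := by linarith
  set wd : ℝ := (wden w : ℝ) with hwd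
  have hwd1 : 1 ≤ wd := by rw [hwd]; exact_mod_cast wden_pos w
  have hDr0 : (0 : ℝ) ≤ D := Nat.cast_nonneg D
  set cN : ℝ := wd ^ 2 * (D * Wb w e R) + 1 with hcN
  have hcNm : 0 ≤ wd ^ 2 * (D * Wb w e R) := by positivity
  have hcN1 : 1 ≤ cN := by rw [hcN]; linarith
  have hcN0 : 0 ≤ cN := by linarith
  set L : ℝ := wd ^ 2 * (D + cG) with hL
  have hL0 : 0 ≤ L := by positivity
  set c₁ : ℝ := 2 * cN + 3 + L with hc₁
  have hc₁0 : 0 ≤ c₁ := by rw [hc₁]; linarith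
  set C : ℝ := Ct * c₁ ^ τ + M + L + 1 + (M + wd * (D + cG)) + |Real.log δ₀| + |Real.log δ₁| +
    |Real.log T| with hC
  have habs0 := abs_nonneg (Real.log δ₀)
  have habs1 := abs_nonneg (Real.log δ₁)
  have habsT := abs_nonneg (Real.log T)
  have hwdc : 0 ≤ wd * (D + cG) := by positivity
  have hCt1 : 0 ≤ Ct * c₁ ^ τ := by positivity
  have hCtr : Ct * c₁ ^ τ + M + L + 1 ≤ C := by rw [hC]; linarith
  have hCpure : M + wd * (D + cG) ≤ C := by rw [hC]; linarith
  have hC0 : 0 ≤ C := by linarith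
  -- THE APPROXIMANT `r = p/q`: `q ≥ ⌈C⌉ + 2`, `|T − r| < exp(−q^m)`
  obtain ⟨r, hden, hne, hlt⟩ := hT (⌈C⌉₊ + 2)
  set q : ℕ := r.den with hq
  have hq2 : 2 ≤ q := le_trans (by omega) hden
  have hq1 : 1 ≤ q := by omega
  have hq1r : (1 : ℝ) ≤ q := by exact_mod_cast hq1
  have hCq : C ≤ (q : ℝ) := by
    have h1 : ((⌈C⌉₊ + 2 : ℕ) : ℝ) ≤ q := by exact_mod_cast hden
    push_cast at h1
    linarith [Nat.le_ceil C]
  set η : ℝ := |T - r| with hη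
  have hη0 : 0 < η := abs_pos.mpr (sub_ne_zero.mpr hne)
  have hηlt : η < Real.exp (-((q : ℝ) ^ m)) := hlt
  have hqm1 : (q : ℝ) ≤ (q : ℝ) ^ m := le_self_pow₀ hq1r (by omega)
  have hηC : η < Real.exp (-C) := hηlt.trans_le (Real.exp_le_exp.mpr (by linarith))
  have hηδ₀ : η < δ₀ := lt_of_abs_log_le hηC hδ₀ (by rw [hC]; linarith)
  have hηδ₁ : η < δ₁ := lt_of_abs_log_le hηC hδ₁ (by rw [hC]; linarith)
  have hηT : η < T := lt_of_abs_log_le hηC hT0 (by rw [hC]; linarith)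
  have hr0 : 0 < r := by
    have h1 := abs_lt.mp (show |T - r| < T from hηT)
    exact_mod_cast (show (0 : ℝ) < r by linarith [h1.2])
  have hr0' : 0 ≤ r := hr0.le
  have hrR : |(r : ℝ)| ≤ R := by
    have h1 : |(r : ℝ)| ≤ |T| + |T - r| := by
      calc |(r : ℝ)| = |T - (T - r)| := by ring_nf
        _ ≤ |T| + |T - r| := abs_sub _ _
    rw [abs_of_pos hT0] at h1
    have hη1 : η ≤ 1 := hηC.le.trans (by rw [Real.exp_le_one_iff]; linarith)
    rw [hR]; linarith
  -- avoidance AT `r`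
  obtain ⟨hfibr, havr⟩ := hball (show dist (r : ℝ) T < δ₀ by rw [Real.dist_eq, abs_sub_comm]; exact hηδ₀)
  have hav : AvoidAt P w e r := by
    intro s hs s' hs' hne'
    have hp : (tail s, tail s') ∈ pairs := Finset.mem_filter.mpr
      ⟨Finset.mem_product.mpr ⟨Finset.mem_image_of_mem _ hs, Finset.mem_image_of_mem _ hs'⟩, hne'⟩
    rcases havr _ hp with h1 | h2
    · left; intro h0; apply h1; rw [aeval_ratCast, h0, Rat.cast_zero]
    · right; rintro ⟨z, hz⟩; apply h2; exact ⟨z, by rw [aeval_ratCast, hz, Rat.cast_intCast]⟩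
  -- THE RADIX NORM `R₀ ∈ ℤ[X]` (tree), non-zero
  have hMn0 : 0 < Mden w e r := Mden_pos w e r
  set R₀ : ℤ[X] := resNorm (Mden w e r) P.support (coef P D r) (Aexp w e r) (Bexp w e r) with hR₀
  have hres := hres_of_avoid hu hv hr0' hav ht
  have hsum := hsum_of_avoid P hD0 hu hv hr0' hav ht hfibr
  have hR0ne : R₀ ≠ 0 := resNorm_ne_zero hMn0 hres hsum
  set x : ℝ := xlev lam (Mden w e r) with hx
  have hx0 : 0 < x := xlev_pos lam _
  -- SIZES: `𝔐 ≤ wd q^K`, `deg R₀ ≤ cN q^{2K}`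
  have hMn : ((Mden w e r : ℕ) : ℝ) ≤ wd * (q : ℝ) ^ K := by
    rw [Mden, hwd, hq, ← hK]; push_cast; exact le_rfl
  have hMnE : ((Mden w e r : ℕ) : ℝ) = wd * (q : ℝ) ^ K := by
    rw [Mden, hwd, hq, ← hK]; push_cast; rfl
  have hAreal : ∀ s ∈ P.support, (Aexp w e r s : ℝ) ≤ (Mden w e r : ℝ) * (D * Wb w e R) := by
    intro s hs
    have h1 : ((Aexp w e r s : ℕ) : ℝ) = ((Mden w e r : ℕ) : ℝ) * ((expo w e r s).1 : ℝ) := by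
      exact_mod_cast Aexp_cast hu e hr0' s
    rw [h1]
    refine mul_le_mul_of_nonneg_left ?_ (Nat.cast_nonneg _)
    have hb := abs_expo_le w e hrR (hD s hs)
    linarith [le_abs_self ((expo w e r s).1 : ℝ), abs_nonneg ((expo w e r s).2 : ℝ)]
  set Asup : ℕ := ⌊((Mden w e r : ℕ) : ℝ) * (D * Wb w e R)⌋₊ with hAsup
  have hAle : ∀ s ∈ P.support, Aexp w e r s ≤ Asup := fun s hs => Nat.le_floor (hAreal s hs)
  set Kb : ℕ := Mden w e r * Asup with hKb
  have hNdeg : R₀.natDegree ≤ Kb := natDegree_resNorm_le hMn0 (coef P D r) (Bexp w e r) hAle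
  have hKbr : (Kb : ℝ) ≤ cN * (q : ℝ) ^ (2 * K) := by
    rw [hKb, Nat.cast_mul]
    have h1 : (Asup : ℝ) ≤ ((Mden w e r : ℕ) : ℝ) * (D * Wb w e R) := Nat.floor_le (by positivity)
    calc ((Mden w e r : ℕ) : ℝ) * (Asup : ℝ) ≤ (wd * (q : ℝ) ^ K) * ((wd * (q : ℝ) ^ K) * (D * Wb w e R)) := by
          rw [← hMnE]; exact mul_le_mul_of_nonneg_left h1 (Nat.cast_nonneg _)
      _ = (wd ^ 2 * (D * Wb w e R)) * (q : ℝ) ^ (2 * K) := by ring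
      _ ≤ cN * (q : ℝ) ^ (2 * K) := mul_le_mul_of_nonneg_right (by rw [hcN]; linarith) (by positivity)
  have hNA : (R₀.natDegree : ℝ) ≤ cN * (q : ℝ) ^ (2 * K) := le_trans (by exact_mod_cast hNdeg) hKbr
  -- TERM BOUNDS: `|coef_s| ≤ |P_s| R^D q^D`, `e^{ρ_λ(expo_s)}, 2^{(expo_s).2} ≤ e^{Λ·D·W}`
  have hl2 : Real.log 2 ≤ 1 := by
    have := Real.log_le_sub_one_of_pos (x := 2) two_pos; linarith
  have hexpo2 : ∀ s ∈ P.support, ((expo w e r s).2 : ℝ) * Real.log 2 ≤ Λ * ((D : ℝ) * Wb w e R) ∧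
      ρrL lam (expo w e r s) ≤ Λ * ((D : ℝ) * Wb w e R) := by
    intro s hs
    have hb := abs_expo_le w e hrR (hD s hs)
    have h1nn : (0 : ℝ) ≤ ((expo w e r s).1 : ℝ) := by exact_mod_cast expo_fst_nonneg hu e hr0' s
    have h2nn : (0 : ℝ) ≤ ((expo w e r s).2 : ℝ) := by exact_mod_cast expo_snd_nonneg hv e hr0' s
    rw [abs_of_nonneg h1nn, abs_of_nonneg h2nn] at hb
    have h2le : ((expo w e r s).2 : ℝ) * Real.log 2 ≤ ((expo w e r s).2 : ℝ) := by
      calc ((expo w e r s).2 : ℝ) * Real.log 2 ≤ ((expo w e r s).2 : ℝ) * 1 :=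
            mul_le_mul_of_nonneg_left hl2 h2nn
        _ = _ := mul_one _
    have h1le : ((expo w e r s).1 : ℝ) * lam ≤ ((expo w e r s).1 : ℝ) * Λ :=
      mul_le_mul_of_nonneg_left hΛlam h1nn
    have h2Λ : ((expo w e r s).2 : ℝ) ≤ ((expo w e r s).2 : ℝ) * Λ := le_mul_of_one_le_right h2nn hΛ1
    have hbΛ : (((expo w e r s).1 : ℝ) + ((expo w e r s).2 : ℝ)) * Λ ≤ ((D : ℝ) * Wb w e R) * Λ :=
      mul_le_mul_of_nonneg_right hb hΛ0
    have hDW : (D : ℝ) * Wb w e R ≤ Λ * ((D : ℝ) * Wb w e R) := le_mul_of_one_le_left (by positivity) hΛ1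
    refine ⟨by linarith, ?_⟩
    rw [ρrL]
    linarith
  have hsum_bound : ∀ f : (Fin (n + 1) →₀ ℕ) → ℝ, (∀ s ∈ P.support, 0 ≤ f s) →
      (∀ s ∈ P.support, f s ≤ Real.exp (Λ * ((D : ℝ) * Wb w e R))) →
      ∑ s ∈ P.support, |(coef P D r s : ℝ)| * f s ≤ (q : ℝ) ^ D * cG := by
    intro f hf0 hf
    have hterm : ∀ s ∈ P.support, |(coef P D r s : ℝ)| * f s ≤
        |((MvPolynomial.coeff s P : ℤ) : ℝ)| * (R ^ D * (q : ℝ) ^ D) * Real.exp (Λ * ((D : ℝ) * Wb w e R)) :=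
      fun s hs => mul_le_mul (abs_coef_le P hR1 hrR (hD0 s hs)) (hf s hs) (hf0 s hs) (by positivity)
    refine (Finset.sum_le_sum hterm).trans ?_
    rw [← Finset.sum_mul, ← Finset.sum_mul, ← hLr]
    have : Lr * (R ^ D * (q : ℝ) ^ D) * Real.exp (Λ * ((D : ℝ) * Wb w e R)) =
        (q : ℝ) ^ D * (Lr * (R ^ D * Real.exp (Λ * ((D : ℝ) * Wb w e R)))) := by ring
    rw [this]
    exact mul_le_mul_of_nonneg_left (by rw [hcG]; linarith) (by positivity)
  -- height `Σ_s |coef_s| c^{B'_s} ≤ q^D c_G`; conjugate sizes `‖G_i(z)‖ ≤ q^D c_G` on the circle `‖z‖ = x`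
  have hH : ∑ s ∈ P.support, |(coef P D r s : ℝ)| * croot (Mden w e r) ^ Bexp w e r s ≤ (q : ℝ) ^ D * cG := by
    rw [height_Gfac_collapse_eq P D hv e hr0']
    exact hsum_bound _ (fun s _ => (Real.exp_pos _).le) fun s hs => Real.exp_le_exp.mpr (hexpo2 s hs).1
  have hGz : ∀ i, ∀ z : ℂ, ‖z‖ = x →
      ‖(Gfac (Mden w e r) P.support (coef P D r) (Aexp w e r) (Bexp w e r) i).eval z‖ ≤ (q : ℝ) ^ D * cG :=
    fun i z hz => (norm_eval_Gfac_levelL_le lam P D hu hv e hr0' i (by rw [hz, hx])).trans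
      (hsum_bound _ (fun s _ => (Real.exp_pos _).le) fun s hs => Real.exp_le_exp.mpr (hexpo2 s hs).2)
  have hR0z : ∀ z : ℂ, ‖z‖ = x → ‖aeval z R₀‖ ≤ ((q : ℝ) ^ D * cG) ^ (Mden w e r) := by
    intro z hz
    rw [hR₀, norm_aeval_resNorm hMn0]
    refine (Finset.prod_le_prod (fun i _ => norm_nonneg _) fun i _ => hGz i z hz).trans ?_
    rw [Finset.prod_const, Finset.card_range]
  have hxn : ‖((x : ℝ) : ℂ)‖ = x := by rw [Complex.norm_real, Real.norm_of_nonneg hx0.le]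
  have hG0 : ‖(Gfac (Mden w e r) P.support (coef P D r) (Aexp w e r) (Bexp w e r) 0).eval (x : ℂ)‖ ≤
      (q : ℝ) ^ D * M * η := by
    rw [hx, eval_Gfac_zeroL lam P hD0 hu hv e hr0', norm_mul, norm_pow, Complex.norm_natCast]
    have h1 : ‖FRL lam P w e r‖ ≤ M * η := by
      have h2 := hlip r (by rw [abs_sub_comm]; exact hηδ₁)
      rw [hFT, sub_zero, abs_sub_comm] at h2
      calc ‖FRL lam P w e r‖ ≤ Kl * η := h2
        _ ≤ M * η := mul_le_mul_of_nonneg_right (by rw [hM]; linarith) hη0.le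
    calc (r.den : ℝ) ^ D * ‖FRL lam P w e r‖ ≤ (q : ℝ) ^ D * (M * η) := by rw [hq]; gcongr
      _ = (q : ℝ) ^ D * M * η := by ring
  have hup : ‖aeval (x : ℂ) R₀‖ ≤ M * ((q : ℝ) ^ D * cG) ^ (Mden w e r) * η := by
    rw [hR₀, norm_aeval_resNorm hMn0]
    set Gn : ℕ → ℝ := fun i =>
      ‖(Gfac (Mden w e r) P.support (coef P D r) (Aexp w e r) (Bexp w e r) i).eval (x : ℂ)‖ with hGn
    change ∏ i ∈ Finset.range (Mden w e r), Gn i ≤ _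
    have hGn0 : ∀ i, 0 ≤ Gn i := fun i => norm_nonneg _
    have hGi : ∀ i, Gn i ≤ (q : ℝ) ^ D * cG := fun i => hGz i _ hxn
    have hG0' : Gn 0 ≤ (q : ℝ) ^ D * M * η := hG0
    obtain ⟨k, hk⟩ := Nat.exists_eq_succ_of_ne_zero hMn0.ne'
    have hsplit : ∏ i ∈ Finset.range (Mden w e r), Gn i = (∏ i ∈ Finset.range k, Gn (i + 1)) * Gn 0 := by
      rw [show Finset.range (Mden w e r) = Finset.range (k + 1) by rw [hk], Finset.prod_range_succ']
    have hP : ∏ i ∈ Finset.range k, Gn (i + 1) ≤ ((q : ℝ) ^ D * cG) ^ k := by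
      refine (Finset.prod_le_prod (fun i _ => hGn0 _) fun i _ => hGi (i + 1)).trans ?_
      rw [Finset.prod_const, Finset.card_range]
    have hqD : (q : ℝ) ^ D ≤ (q : ℝ) ^ D * cG := le_mul_of_one_le_right (by positivity) hcG1
    rw [hsplit]
    calc (∏ i ∈ Finset.range k, Gn (i + 1)) * Gn 0
        ≤ ((q : ℝ) ^ D * cG) ^ k * ((q : ℝ) ^ D * M * η) := mul_le_mul hP hG0' (hGn0 0) (by positivity)
      _ ≤ ((q : ℝ) ^ D * cG) ^ k * (((q : ℝ) ^ D * cG) * M * η) := by gcongr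
      _ = M * ((q : ℝ) ^ D * cG) ^ (k + 1) * η := by ring
      _ = M * ((q : ℝ) ^ D * cG) ^ (Mden w e r) * η := by rw [hk]
  -- CONSTANT BRANCH (`deg R₀ = 0`): the pure endgame (tree), order `K + 2 ≤ m`
  have hKm : K + 2 ≤ m := by
    have h1 : a ≤ a * τ := Nat.le_mul_of_pos_right _ hτ
    omega
  rcases Nat.eq_zero_or_pos R₀.natDegree with hdeg | hNpos
  · have hlow : (1 : ℝ) ≤ ‖aeval (x : ℂ) R₀‖ := by
      have hac : R₀ = Polynomial.C (R₀.coeff 0) := Polynomial.eq_C_of_natDegree_eq_zero hdeg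
      have ha0 : R₀.coeff 0 ≠ 0 := fun h => hR0ne (by rw [hac, h, map_zero])
      rw [hac, aeval_C, algebraMap_int_eq, eq_intCast, Complex.norm_intCast]
      exact_mod_cast Int.one_le_abs ha0
    exact endgame_pure hq2 hM0 hcG1 hwd1 hMn hKm (hCpure.trans hCq) hηlt (hlow.trans hup)
  -- THE POWER NORM `R̃ = Res_X(R₀, X^𝔐 − Y)` AND ITS VALUE AT `κ = e^λ`
  set X : ℝ := (q : ℝ) ^ D * cG with hX
  have hX1 : 1 ≤ X := one_le_mul_of_one_le_of_one_le (one_le_pow₀ hq1r) hcG1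
  have hXM1 : 1 ≤ X ^ Mden w e r := one_le_pow₀ hX1
  set N : ℕ := R₀.natDegree with hN
  have hN1 : 1 ≤ N := hNpos
  have hRt0 : powerNorm (Mden w e r) R₀ ≠ 0 := powerNorm_ne_zero _ hR0ne
  have hRtdeg : (powerNorm (Mden w e r) R₀).natDegree ≤ N := (natDegree_powerNorm _ hR0ne).le
  have hxκ : ((x : ℝ) : ℂ) ^ Mden w e r = cexp (lam : ℂ) := by rw [hx]; exact xlev_pow_complex lam hMn0.ne'
  have hV : ‖aeval (cexp (lam : ℂ)) (powerNorm (Mden w e r) R₀)‖ ≤ M * (X ^ Mden w e r) ^ Mden w e r * η := by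
    rw [norm_aeval_powerNorm hMn0 R₀ hxκ]
    obtain ⟨k, hk⟩ := Nat.exists_eq_succ_of_ne_zero hMn0.ne'
    have hsplit : ∏ j ∈ Finset.range (Mden w e r), ‖aeval (zroot (Mden w e r) ^ j * (x : ℂ)) R₀‖ =
        (∏ j ∈ Finset.range k, ‖aeval (zroot (Mden w e r) ^ (j + 1) * (x : ℂ)) R₀‖) *
          ‖aeval (zroot (Mden w e r) ^ 0 * (x : ℂ)) R₀‖ := by
      rw [show Finset.range (Mden w e r) = Finset.range (k + 1) by rw [hk], Finset.prod_range_succ']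
    rw [hsplit, pow_zero, one_mul]
    have hP : ∏ j ∈ Finset.range k, ‖aeval (zroot (Mden w e r) ^ (j + 1) * (x : ℂ)) R₀‖ ≤
        (X ^ Mden w e r) ^ k := by
      refine (Finset.prod_le_prod (fun i _ => norm_nonneg _) fun i _ =>
        hR0z _ (norm_zroot_pow_mul hMn0.ne' (i + 1) hx0.le)).trans ?_
      rw [Finset.prod_const, Finset.card_range]
    calc (∏ j ∈ Finset.range k, ‖aeval (zroot (Mden w e r) ^ (j + 1) * (x : ℂ)) R₀‖) * ‖aeval (x : ℂ) R₀‖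
        ≤ (X ^ Mden w e r) ^ k * (M * X ^ Mden w e r * η) := mul_le_mul hP hup (norm_nonneg _) (by positivity)
      _ = M * (X ^ Mden w e r) ^ (k + 1) * η := by ring
      _ = M * (X ^ Mden w e r) ^ Mden w e r * η := by rw [hk]
  -- `(X^𝔐)^𝔐 ≤ exp(L q^a)`, `L = wd²(D + c_G)`, `a = 2K + 1`
  have hLexp : X ^ Mden w e r ≤ Real.exp (wd * (q : ℝ) ^ K * ((D + cG) * q)) := pow_collapse_le_exp hq1 hcG1 hMn
  have hXp : (X ^ Mden w e r) ^ Mden w e r ≤ Real.exp (L * (q : ℝ) ^ a) := by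
    calc (X ^ Mden w e r) ^ Mden w e r ≤ (Real.exp (wd * (q : ℝ) ^ K * ((D + cG) * q))) ^ Mden w e r :=
          pow_le_pow_left₀ (by positivity) hLexp _
      _ = Real.exp ((Mden w e r : ℝ) * (wd * (q : ℝ) ^ K * ((D + cG) * q))) := by rw [← Real.exp_nat_mul]
      _ ≤ Real.exp (L * (q : ℝ) ^ a) := Real.exp_le_exp.mpr (by
          have h1 : (Mden w e r : ℝ) * (wd * (q : ℝ) ^ K * ((D + cG) * q)) ≤
              (wd * (q : ℝ) ^ K) * (wd * (q : ℝ) ^ K * ((D + cG) * q)) :=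
            mul_le_mul_of_nonneg_right hMn (by positivity)
          have h2 : (wd * (q : ℝ) ^ K) * (wd * (q : ℝ) ^ K * ((D + cG) * q)) = L * (q : ℝ) ^ a := by
            rw [hL, ha]; ring
          linarith)
  -- HEIGHT OF `R̃`: `|coeff| ≤ 2^N (X^𝔐)^𝔐 =: Hr`, `H := ⌈Hr⌉ + 16`, `log H ≤ 3 + N + L q^a`
  have hMR : (R₀.map (Int.castRingHom ℂ)).mahlerMeasure ≤ X ^ Mden w e r :=
    mahlerMeasure_resNorm_le hMn0 _ _ _ _ hH
  set Hr : ℝ := 2 ^ N * (X ^ Mden w e r) ^ Mden w e r with hHr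
  have hHr1 : 1 ≤ Hr := one_le_mul_of_one_le_of_one_le (one_le_pow₀ (by norm_num)) (one_le_pow₀ hXM1)
  have hHr0 : 0 ≤ Hr := by linarith
  have hcoefR : ∀ k, (|(powerNorm (Mden w e r) R₀).coeff k| : ℝ) ≤ Hr := fun k =>
    (abs_coeff_powerNorm_le _ hR0ne k).trans (mul_le_mul_of_nonneg_left
      (pow_le_pow_left₀ (mahlerMeasure_nonneg _) hMR _) (by positivity))
  set H : ℕ := ⌈Hr⌉₊ + 16 with hHdef
  have h16 : 16 ≤ H := by omega
  have hH1 : 1 ≤ H := by omega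
  have hHle : (H : ℝ) ≤ Hr + 17 := by
    rw [hHdef]; push_cast; linarith [Nat.ceil_lt_add_one hHr0]
  have hcoef : ∀ k, |(powerNorm (Mden w e r) R₀).coeff k| ≤ (H : ℤ) := by
    intro k
    have h1 : ((|(powerNorm (Mden w e r) R₀).coeff k| : ℤ) : ℝ) ≤ (H : ℝ) := by
      rw [Int.cast_abs]
      refine (hcoefR k).trans ?_
      rw [hHdef]; push_cast; linarith [Nat.le_ceil Hr]
    exact_mod_cast h1
  have hH0 : (0 : ℝ) < H := by exact_mod_cast (show 0 < H by omega)
  have h2e : (2 : ℝ) ≤ Real.exp 1 := by linarith [Real.add_one_le_exp (1 : ℝ)]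
  have h2N : (2 : ℝ) ^ N ≤ Real.exp N := by
    calc (2 : ℝ) ^ N ≤ (Real.exp 1) ^ N := pow_le_pow_left₀ (by norm_num) h2e N
      _ = Real.exp N := by rw [← Real.exp_nat_mul, mul_one]
  have h18 : (18 : ℝ) ≤ Real.exp 3 := by
    have h27 : (2.7 : ℝ) ≤ Real.exp 1 := by linarith [Real.exp_one_gt_d9]
    calc (18 : ℝ) ≤ (2.7 : ℝ) ^ 3 := by norm_num
      _ ≤ (Real.exp 1) ^ 3 := pow_le_pow_left₀ (by norm_num) h27 3
      _ = Real.exp 3 := by rw [← Real.exp_nat_mul]; norm_num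
  have hlogH : Real.log H ≤ 3 + N + L * (q : ℝ) ^ a := by
    rw [Real.log_le_iff_le_exp hH0, Real.exp_add, Real.exp_add]
    calc (H : ℝ) ≤ Hr + 17 := hHle
      _ ≤ 18 * Hr := by linarith
      _ = 18 * (2 ^ N * (X ^ Mden w e r) ^ Mden w e r) := by rw [hHr]
      _ ≤ Real.exp 3 * (Real.exp N * Real.exp (L * (q : ℝ) ^ a)) :=
          mul_le_mul h18 (mul_le_mul h2N hXp (by positivity) (Real.exp_pos _).le) (by positivity)
            (Real.exp_pos _).le
      _ = Real.exp 3 * Real.exp N * Real.exp (L * (q : ℝ) ^ a) := by ring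
  -- `Φ = N + log H ≤ c₁ q^a`
  set Φ : ℝ := (N : ℝ) + Real.log H with hΦ
  have hlogH0 : 0 ≤ Real.log H := Real.log_nonneg (by exact_mod_cast hH1)
  have hΦ0 : 0 ≤ Φ := by positivity
  have hNr : (N : ℝ) ≤ cN * (q : ℝ) ^ (2 * K) := hNA
  have hq2K : (q : ℝ) ^ (2 * K) ≤ (q : ℝ) ^ a := pow_le_pow_right₀ hq1r (by omega)
  have hqa1 : (1 : ℝ) ≤ (q : ℝ) ^ a := one_le_pow₀ hq1r
  have hΦle : Φ ≤ c₁ * (q : ℝ) ^ a := by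
    have h1 : cN * (q : ℝ) ^ (2 * K) ≤ cN * (q : ℝ) ^ a := mul_le_mul_of_nonneg_left hq2K hcN0
    rw [hΦ, hc₁]
    linarith
  -- THE TYPE OF THE FIXED NUMBER `κ = e^λ` AT `R̃`, and the budget
  have hlow := hmeas (powerNorm (Mden w e r) R₀) N H hRt0 hN1 hRtdeg h16 hcoef
  exact endgame_transport hq1 hCt0.le hM0 hL0 hτ hm hΦ0 hΦle hlow hV hXp hη0.le hηlt (hCtr.trans hCq)

end Engine

end Summit.Schanuel.Schanuel.Theorems.RootDecomp1ELevelTransport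

end
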